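import Mathlib
import HarnessLib
import Literature.Analysis.Convex.FenchelConjugate
import Literature.Analysis.Convex.ConvexSandwichTheorem

/-!
# Fenchel's duality theorem (Rockafellar 1970, §31)

Rockafellar, *Convex Analysis* (1970), Section 31 «Fenchel's Duality Theorem», pp. 327–335:
Theorem 31.1 (the convex–concave form `inf (f − g) = max (g_* − f*)`), Corollary 31.2.1 (the form
with a linear map, `inf {f(x) + g(Ax)} = max {−f*(A*y*) − g*(−y*)}` in the Borwein–Zhu sign
convention of the sibling anchor `FenchelConjugate`), Theorem 31.3 and Corollary 31.3.1 (the
Kuhn–Tucker conditions `A*y* ∈ ∂f(x)`, `−y* ∈ ∂g(Ax)` characterise optimal pairs), Theorem 31.4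
(minimising over a convex cone: `inf_K f = −inf_{K*} f*`, with its optimality conditions
`x* ∈ ∂f(x)`, `⟨x, x*⟩ = 0`) and Corollary 31.4.2 (minimising over a subspace:
`inf_L f = −inf_{L^⊥} f*`).  Everything is proved; there are no new definitions.

## Encoding (declared deviations from the printed text)

* As in `FenchelConjugate` (Borwein–Zhu §4.4), `X`, `Y` are real normed spaces, `x*` ranges over
  `X →L[ℝ] ℝ`, `A*y* = y*.comp A`, and an extended-valued convex function of the book is a real
  function `f` with an effective domain `Df`; its conjugate is `fenchelConj Df f` (values in
  `EReal`), the primal and dual values of the Fenchel problem are `fenchelPrimalValue` /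
  `fenchelDualValue`, a concave `g` is a real `g` with `ConcaveOn ℝ Dg g` and its concave conjugate
  is `concaveConj Dg g` (Borwein–Zhu Exercise 4.4.9); `g_*(x*) = −(−g)*(−x*)` (§30, p. 308) is
  `concaveConj_eq_neg_fenchelConj_neg`.  Rockafellar's `f(x) − g(Ax)` with `g` concave is
  Borwein–Zhu's `f(x) + k(Ax)` with `k = −g` convex, and `g*(u*) − f*(A*u*)` (concave conjugate)
  is `−f*(A*u*) − k*(−u*)`; the statements with a linear map are given in the latter form.
* The relative-interior qualifications `ri (dom f) ∩ ri (dom g) ≠ ∅` (condition (a)) are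
  finite-dimensional; they are the subject of the sibling anchor `RelativeInteriorQualification`
  (Thm 31.1 (a), Cor 31.2.1 (a) over `intrinsicInterior`).  In a general normed space we use here,
  exactly as the sibling anchor `DualOperations` does for §16, the interior-point qualification of
  the tree's decoupling lemma
  `ConvexSandwichTheorem.decoupling` (Borwein–Zhu (4.3.2)): a point `x₀ ∈ dom f` such that `dom g`
  is a neighbourhood of `Ax₀` at which `g` is continuous.  Under it the conclusions of condition
  (a) hold: no duality gap and attainment in the dual (`fenchel_duality`, which is Borwein–Zhu's
  Theorem 4.4.3 assembled from the tree's `decoupling` and `fenchel_strong_duality_of_decoupling`,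
  including the unbounded case `inf = −∞`).  For Theorem 31.4 / Corollary 31.4.2 the qualification
  is put on `f` (a point of the cone / subspace at which `dom f` is a neighbourhood and `f` is
  continuous), since a cone or subspace typically has empty interior.
* `K* = −K°` is written as the set `{x* | ∀ x ∈ K, 0 ≤ ⟨x*, x⟩}` (`K° = negPolarCone K` in
  `FenchelConjugate`), `L^⊥` as `{x* | ∀ x ∈ L, ⟨x*, x⟩ = 0}`, and `−inf_{K*} f*` as
  `sup_{x* ∈ K*} (−f*(x*))`.
* NOT formalised: conditions (b) (closedness with the dual qualification) and the polyhedral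
  refinements of Theorems 31.1, 31.4 and Corollary 31.2.1; Theorem 31.2 (the bifunction / convex
  program reading of §§29–30); Corollary 31.4.1 (the non-negative orthant); Theorem 31.5 (Moreau)
  and its corollaries, which are the subject of the sibling anchor `ProximalMap`.

## Main statements (all proved; no named facts, no `sorry`)

* `fenchel_duality` — Cor 31.2.1 (a) / Borwein–Zhu Thm 4.4.3: `p = d` and the dual is attained.
* `add_eq_dualObjective_iff`, `optimal_of_kuhnTucker`, `kuhnTucker_iff` — Thm 31.3;
  `isMinOn_iff_exists_kuhnTucker` — Cor 31.3.1.
* `concaveConj_eq_neg_fenchelConj_neg` (§30 p. 308), `iInf_sub_eq_iSup_concaveConj_sub` —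
  Thm 31.1 (a).
* `neg_fenchelConj_le_of_mem_cone`, `iInf_cone_eq_iSup_neg_fenchelConj`,
  `coe_eq_neg_fenchelConj_iff`, `isMinOn_of_coe_eq_neg_fenchelConj` — Thm 31.4;
  `iInf_submodule_eq_iSup_neg_fenchelConj` — Cor 31.4.2.

## References

* R. T. Rockafellar, *Convex Analysis*, Princeton University Press 1970, §31, pp. 327–335
  (held copy `book:rockafellarnd-convex-analysis`, chunks p0282–p0289: Thm 31.1 p0282, Thm 31.2
  p0284, Cor 31.2.1 p0285–p0286, Thm 31.3 and Cor 31.3.1 p0287, Thm 31.4 p0288, Cor 31.4.2 p0289;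
  §30 p. 308 = chunk p0267 for `g_* = −(−g)*(−·)`).  Key `Rockafellar1970`.
* J. M. Borwein, Q. J. Zhu, *Techniques of Variational Analysis*, Springer 2005, §4.3–§4.4
  (Lemma 4.3.1, Theorems 4.4.2–4.4.3, Exercise 4.4.9).  Key `BorweinZhu2005`.
-/

open Set Filter
open scoped Topology

namespace Literature.Analysis.Convex.FenchelDualityTheorem

open Literature.Analysis.Convex.FenchelConjugate (fenchelConj fenchelDom fenchelPrimalValue
  fenchelDualValue fenchel_weak_duality fenchel_strong_duality_of_decoupling
  fenchelDualObjective_le le_fenchelConj bot_lt_fenchelConj fenchelConj_eq_iff_subgradient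
  concaveConj negPolarCone mem_negPolarCone_iff)
open Literature.Analysis.Convex.ConvexSandwichTheorem (decoupling)

variable {X Y : Type*} [NormedAddCommGroup X] [NormedSpace ℝ X] [NormedAddCommGroup Y]
  [NormedSpace ℝ Y]

section General

variable {Df : Set X} {f : X → ℝ} {Dg : Set Y} {g : Y → ℝ}

/-- The primal value is the greatest lower bound of the primal objective values whenever it is
not `−∞` and the feasible set is non-empty. [folklore] -/
private theorem isGLB_of_fenchelPrimalValue_ne_bot (A : X →L[ℝ] Y) {x₀ : X} (hx₀ : x₀ ∈ Df)
    (hAx₀ : A x₀ ∈ Dg) (hbot : fenchelPrimalValue Df f Dg g A ≠ ⊥) :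
    fenchelPrimalValue Df f Dg g A = (((fenchelPrimalValue Df f Dg g A).toReal : ℝ) : EReal) ∧
      IsGLB ((fun x => f x + g (A x)) '' {x ∈ Df | A x ∈ Dg})
        (fenchelPrimalValue Df f Dg g A).toReal := by
  have hle : ∀ x ∈ {x ∈ Df | A x ∈ Dg},
      fenchelPrimalValue Df f Dg g A ≤ ((f x + g (A x) : ℝ) : EReal) := fun x hx =>
    iInf₂_le (f := fun x (_ : x ∈ {x ∈ Df | A x ∈ Dg}) => ((f x + g (A x) : ℝ) : EReal)) x hx
  have htop : fenchelPrimalValue Df f Dg g A ≠ ⊤ :=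
    ne_top_of_le_ne_top (EReal.coe_ne_top _) (hle x₀ ⟨hx₀, hAx₀⟩)
  have heq : fenchelPrimalValue Df f Dg g A =
      (((fenchelPrimalValue Df f Dg g A).toReal : ℝ) : EReal) := (EReal.coe_toReal htop hbot).symm
  refine ⟨heq, ?_, ?_⟩
  · rintro _ ⟨x, hx, rfl⟩
    have h := hle x hx
    rw [heq, EReal.coe_le_coe_iff] at h
    exact h
  · intro b hb
    have h : (b : EReal) ≤ fenchelPrimalValue Df f Dg g A :=
      le_iInf₂ fun x hx => EReal.coe_le_coe_iff.2 (hb ⟨x, hx, rfl⟩)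
    rw [heq, EReal.coe_le_coe_iff] at h
    exact h

/-- **Fenchel's duality theorem** (Rockafellar's Corollary 31.2.1 under condition (a); Borwein–Zhu's
Theorem 4.4.3 in full): if `f` is convex on `dom f`, `g` is convex on `dom g`, and some
`x₀ ∈ dom f` has `dom g` a neighbourhood of `Ax₀` at which `g` is continuous, then
`inf_x {f(x) + g(Ax)} = sup_{y*} {−f*(A*y*) − g*(−y*)}` and the supremum is attained.
[cite: Rockafellar1970, §31 Cor 31.2.1 (a) (held chunk p0285–p0286); BorweinZhu2005, Thm 4.4.3
p. 136] -/
theorem fenchel_duality (hf : ConvexOn ℝ Df f) (hg : ConvexOn ℝ Dg g) (A : X →L[ℝ] Y) {x₀ : X}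
    (hx₀ : x₀ ∈ Df) (hDg : Dg ∈ 𝓝 (A x₀)) (hgc : ContinuousAt g (A x₀)) :
    fenchelPrimalValue Df f Dg g A = fenchelDualValue Df f Dg g A ∧
      ∃ ys : Y →L[ℝ] ℝ, -fenchelConj Df f (ys.comp A) - fenchelConj Dg g (-ys) =
        fenchelDualValue Df f Dg g A := by
  have hAx₀ : A x₀ ∈ Dg := mem_of_mem_nhds hDg
  have hweak := fenchel_weak_duality Df f Dg g A
  by_cases hbot : fenchelPrimalValue Df f Dg g A = ⊥
  · -- an unbounded primal problem: the dual value is `−∞` too, attained everywhere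
    have hd : fenchelDualValue Df f Dg g A = ⊥ := le_bot_iff.1 (hbot ▸ hweak)
    refine ⟨hbot.trans hd.symm, 0, le_antisymm ?_ bot_le |>.trans hd.symm⟩
    · exact hd ▸ le_iSup (fun ys : Y →L[ℝ] ℝ =>
        -fenchelConj Df f (ys.comp A) - fenchelConj Dg g (-ys)) 0
  · obtain ⟨heq, hglb⟩ := isGLB_of_fenchelPrimalValue_ne_bot A hx₀ hAx₀ hbot
    set p := (fenchelPrimalValue Df f Dg g A).toReal
    obtain ⟨ys, hys⟩ := decoupling hf hg A hx₀ hDg hgc (p := p)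
      (fun x hx hAx => hglb.1 ⟨x, ⟨hx, hAx⟩, rfl⟩)
    obtain ⟨h1, h2, h3⟩ := fenchel_strong_duality_of_decoupling hglb hys
    exact ⟨h1.trans h2.symm, ys, h3.trans h2.symm⟩

/-! ### Theorem 31.3 and Corollary 31.3.1: the Kuhn–Tucker conditions -/

/-- **Theorem 31.3**, the computation in its proof: for a feasible `x` and any `y*`, the primal
objective at `x` equals the dual objective at `y*` iff the **Kuhn–Tucker conditions**
`A*y* ∈ ∂f(x)` and `−y* ∈ ∂g(Ax)` hold (subgradients in the sense `⟨x*, y − x⟩ ≤ f(y) − f(x)` on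
the effective domain).  No closedness or qualification is needed.
[cite: Rockafellar1970, §31 Thm 31.3 (held chunk p0287)] -/
theorem add_eq_dualObjective_iff (A : X →L[ℝ] Y) {x : X} (hx : x ∈ Df) (hAx : A x ∈ Dg)
    (ys : Y →L[ℝ] ℝ) :
    ((f x + g (A x) : ℝ) : EReal) = -fenchelConj Df f (ys.comp A) - fenchelConj Dg g (-ys) ↔
      (∀ y ∈ Df, (ys.comp A) (y - x) ≤ f y - f x) ∧
        ∀ u ∈ Dg, (-ys) (u - A x) ≤ g u - g (A x) := by
  rw [← fenchelConj_eq_iff_subgradient hx (ys.comp A), ← fenchelConj_eq_iff_subgradient hAx (-ys)]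
  set F := fenchelConj Df f (ys.comp A) with hFdef
  set G := fenchelConj Dg g (-ys) with hGdef
  have hF : (((ys.comp A) x - f x : ℝ) : EReal) ≤ F := le_fenchelConj (ys.comp A) hx
  have hG : (((-ys) (A x) - g (A x) : ℝ) : EReal) ≤ G := le_fenchelConj (-ys) hAx
  have hsum : (ys.comp A) x - f x + ((-ys) (A x) - g (A x)) = -(f x + g (A x)) := by
    simp only [ContinuousLinearMap.comp_apply, neg_apply]; ring
  constructor
  · intro h
    -- both conjugate values are finite
    have hFt : F ≠ ⊤ := by
      intro hFt
      rw [hFt, EReal.neg_top, EReal.bot_sub] at h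
      exact EReal.coe_ne_bot _ h
    have hGt : G ≠ ⊤ := by
      intro hGt
      rw [hGt, EReal.sub_top] at h
      exact EReal.coe_ne_bot _ h
    have hFb : F ≠ ⊥ := ne_bot_of_gt (lt_of_lt_of_le (EReal.bot_lt_coe _) hF)
    have hGb : G ≠ ⊥ := ne_bot_of_gt (lt_of_lt_of_le (EReal.bot_lt_coe _) hG)
    obtain ⟨F', hF'⟩ : ∃ r : ℝ, F = r := ⟨F.toReal, (EReal.coe_toReal hFt hFb).symm⟩
    obtain ⟨G', hG'⟩ : ∃ r : ℝ, G = r := ⟨G.toReal, (EReal.coe_toReal hGt hGb).symm⟩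
    rw [hF', hG'] at h ⊢
    rw [hF', EReal.coe_le_coe_iff] at hF
    rw [hG', EReal.coe_le_coe_iff] at hG
    rw [← EReal.coe_neg, ← EReal.coe_sub, EReal.coe_eq_coe_iff] at h
    refine ⟨?_, ?_⟩ <;> rw [EReal.coe_eq_coe_iff] <;> linarith
  · rintro ⟨h1, h2⟩
    rw [h1, h2, ← EReal.coe_neg, ← EReal.coe_sub, EReal.coe_eq_coe_iff]
    linarith

/-- **Theorem 31.3**, sufficiency: a pair `(x, y*)` satisfying the Kuhn–Tucker conditions is
optimal — `x` attains the primal infimum, `y*` the dual supremum, and the two values agree.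
[cite: Rockafellar1970, §31 Thm 31.3 (held chunk p0287)] -/
theorem optimal_of_kuhnTucker (A : X →L[ℝ] Y) {x : X} (hx : x ∈ Df) (hAx : A x ∈ Dg)
    {ys : Y →L[ℝ] ℝ} (h1 : ∀ y ∈ Df, (ys.comp A) (y - x) ≤ f y - f x)
    (h2 : ∀ u ∈ Dg, (-ys) (u - A x) ≤ g u - g (A x)) :
    fenchelPrimalValue Df f Dg g A = ((f x + g (A x) : ℝ) : EReal) ∧
      fenchelDualValue Df f Dg g A = -fenchelConj Df f (ys.comp A) - fenchelConj Dg g (-ys) ∧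
        fenchelPrimalValue Df f Dg g A = fenchelDualValue Df f Dg g A := by
  have heq := (add_eq_dualObjective_iff A hx hAx ys).2 ⟨h1, h2⟩
  have hP : fenchelPrimalValue Df f Dg g A ≤ ((f x + g (A x) : ℝ) : EReal) :=
    iInf₂_le (f := fun x (_ : x ∈ {x ∈ Df | A x ∈ Dg}) => ((f x + g (A x) : ℝ) : EReal)) x
      ⟨hx, hAx⟩
  have hD : -fenchelConj Df f (ys.comp A) - fenchelConj Dg g (-ys) ≤
      fenchelDualValue Df f Dg g A :=
    le_iSup (fun ys : Y →L[ℝ] ℝ => -fenchelConj Df f (ys.comp A) - fenchelConj Dg g (-ys)) ys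
  have hW := fenchel_weak_duality Df f Dg g A
  rw [← heq] at hD
  refine ⟨le_antisymm hP (hD.trans hW), ?_, le_antisymm ?_ hW⟩
  · rw [← heq]; exact le_antisymm (hW.trans hP) hD
  · exact hP.trans hD

/-- **Theorem 31.3**: `x` and `y*` satisfy
`f(x) + g(Ax) = inf (f + gA) = sup (−f*A* − g*(−·)) = −f*(A*y*) − g*(−y*)` if and only if they
satisfy the Kuhn–Tucker conditions. [cite: Rockafellar1970, §31 Thm 31.3 (held chunk p0287)] -/
theorem kuhnTucker_iff (A : X →L[ℝ] Y) {x : X} (hx : x ∈ Df) (hAx : A x ∈ Dg)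
    (ys : Y →L[ℝ] ℝ) :
    (fenchelPrimalValue Df f Dg g A = ((f x + g (A x) : ℝ) : EReal) ∧
      fenchelDualValue Df f Dg g A = -fenchelConj Df f (ys.comp A) - fenchelConj Dg g (-ys) ∧
        fenchelPrimalValue Df f Dg g A = fenchelDualValue Df f Dg g A) ↔
      (∀ y ∈ Df, (ys.comp A) (y - x) ≤ f y - f x) ∧
        ∀ u ∈ Dg, (-ys) (u - A x) ≤ g u - g (A x) := by
  constructor
  · rintro ⟨hP, hD, hPD⟩
    exact (add_eq_dualObjective_iff A hx hAx ys).1 (hP.symm.trans (hPD.trans hD))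
  · rintro ⟨h1, h2⟩
    exact optimal_of_kuhnTucker A hx hAx h1 h2

/-- **Corollary 31.3.1**: under the qualification of `fenchel_duality`, a feasible `x` minimises
`f + gA` if and only if some `y*` satisfies the Kuhn–Tucker conditions together with `x`.
[cite: Rockafellar1970, §31 Cor 31.3.1 (held chunk p0287)] -/
theorem isMinOn_iff_exists_kuhnTucker (hf : ConvexOn ℝ Df f) (hg : ConvexOn ℝ Dg g)
    (A : X →L[ℝ] Y) {x₀ : X} (hx₀ : x₀ ∈ Df) (hDg : Dg ∈ 𝓝 (A x₀)) (hgc : ContinuousAt g (A x₀))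
    {x : X} (hx : x ∈ Df) (hAx : A x ∈ Dg) :
    IsMinOn (fun x => f x + g (A x)) {x ∈ Df | A x ∈ Dg} x ↔
      ∃ ys : Y →L[ℝ] ℝ, (∀ y ∈ Df, (ys.comp A) (y - x) ≤ f y - f x) ∧
        ∀ u ∈ Dg, (-ys) (u - A x) ≤ g u - g (A x) := by
  constructor
  · intro hmin
    obtain ⟨hPD, ys, hys⟩ := fenchel_duality hf hg A hx₀ hDg hgc
    have hP : fenchelPrimalValue Df f Dg g A = ((f x + g (A x) : ℝ) : EReal) := by
      refine le_antisymm (iInf₂_le (f := fun x (_ : x ∈ {x ∈ Df | A x ∈ Dg}) =>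
        ((f x + g (A x) : ℝ) : EReal)) x ⟨hx, hAx⟩) (le_iInf₂ fun y hy => ?_)
      exact EReal.coe_le_coe_iff.2 (hmin hy)
    exact ⟨ys, (add_eq_dualObjective_iff A hx hAx ys).1 (hP.symm.trans (hPD.trans hys.symm))⟩
  · rintro ⟨ys, h1, h2⟩ y hy
    have h := (optimal_of_kuhnTucker A hx hAx h1 h2).1
    have hle : fenchelPrimalValue Df f Dg g A ≤ ((f y + g (A y) : ℝ) : EReal) :=
      iInf₂_le (f := fun x (_ : x ∈ {x ∈ Df | A x ∈ Dg}) => ((f x + g (A x) : ℝ) : EReal)) y hy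
    rw [h, EReal.coe_le_coe_iff] at hle
    exact hle

end General

section Symmetric

/-! ### Theorem 31.1: the convex–concave form -/

variable {Df Dg : Set X} {f g : X → ℝ}

/-- The concave conjugate in terms of the convex one: `g_*(x*) = −(−g)*(−x*)`.
[cite: Rockafellar1970, §30 p. 308 (held chunk p0267)] -/
theorem concaveConj_eq_neg_fenchelConj_neg (Dg : Set X) (g : X → ℝ) (xs : X →L[ℝ] ℝ) :
    concaveConj Dg g xs = -fenchelConj Dg (fun x => -g x) (-xs) := by
  have hval : ∀ x, (-xs) x - -g x = -(xs x - g x) := fun x => by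
    simp only [neg_apply]; ring
  apply le_antisymm
  · -- `g_* ≤ −(−g)*(−x*)`, i.e. `(−g)*(−x*) ≤ −g_*`
    refine EReal.le_neg_of_le_neg (iSup₂_le fun x hx => EReal.le_neg_of_le_neg ?_)
    rw [hval, EReal.coe_neg, neg_neg]
    exact Literature.Analysis.Convex.FenchelConjugate.concaveConj_le xs hx
  · refine le_iInf₂ fun x hx => EReal.neg_le.2 ?_
    rw [← EReal.coe_neg, ← hval x]
    exact le_fenchelConj (f := fun x => -g x) (-xs) hx

/-- **Theorem 31.1 (Fenchel's Duality Theorem)** under condition (a), encoded with the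
interior-point qualification: if `f` is convex on `dom f`, `g` is concave on `dom g`, and some
`x₀ ∈ dom f` has `dom g` a neighbourhood of `x₀` at which `g` is continuous, then
`inf_x {f(x) − g(x)} = sup_{x*} {g_*(x*) − f*(x*)}`, the supremum being attained.
[cite: Rockafellar1970, §31 Thm 31.1 (a) (held chunk p0282)] -/
theorem iInf_sub_eq_iSup_concaveConj_sub (hf : ConvexOn ℝ Df f) (hg : ConcaveOn ℝ Dg g) {x₀ : X}
    (hx₀ : x₀ ∈ Df) (hDg : Dg ∈ 𝓝 x₀) (hgc : ContinuousAt g x₀) :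
    ⨅ x ∈ Df ∩ Dg, ((f x - g x : ℝ) : EReal) =
        ⨆ xs : X →L[ℝ] ℝ, (concaveConj Dg g xs - fenchelConj Df f xs) ∧
      ∃ xs : X →L[ℝ] ℝ, concaveConj Dg g xs - fenchelConj Df f xs =
        ⨆ xs : X →L[ℝ] ℝ, (concaveConj Dg g xs - fenchelConj Df f xs) := by
  have hg' : ConvexOn ℝ Dg (fun x => -g x) := hg.neg
  have hgc' : ContinuousAt (fun x => -g x) ((ContinuousLinearMap.id ℝ X) x₀) := hgc.neg
  have hDg' : Dg ∈ 𝓝 ((ContinuousLinearMap.id ℝ X) x₀) := hDg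
  obtain ⟨hPD, ys, hys⟩ := fenchel_duality hf hg' (ContinuousLinearMap.id ℝ X) hx₀ hDg' hgc'
  have hP : fenchelPrimalValue Df f Dg (fun x => -g x) (ContinuousLinearMap.id ℝ X) =
      ⨅ x ∈ Df ∩ Dg, ((f x - g x : ℝ) : EReal) := by
    simp only [fenchelPrimalValue, ContinuousLinearMap.coe_id', id_eq, sep_mem_eq,
      ← sub_eq_add_neg]
  have hterm : ∀ xs : X →L[ℝ] ℝ,
      -fenchelConj Df f (xs.comp (ContinuousLinearMap.id ℝ X)) -
          fenchelConj Dg (fun x => -g x) (-xs) = concaveConj Dg g xs - fenchelConj Df f xs := by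
    intro xs
    rw [ContinuousLinearMap.comp_id, concaveConj_eq_neg_fenchelConj_neg, sub_eq_add_neg,
      sub_eq_add_neg, add_comm]
  have hD : fenchelDualValue Df f Dg (fun x => -g x) (ContinuousLinearMap.id ℝ X) =
      ⨆ xs : X →L[ℝ] ℝ, (concaveConj Dg g xs - fenchelConj Df f xs) := by
    simp only [fenchelDualValue, hterm]
  refine ⟨hP ▸ hD ▸ hPD, ys, ?_⟩
  rw [← hterm, hys, hD]

end Symmetric

section Cone

/-! ### Theorem 31.4 and Corollary 31.4.2: minimising over a cone or a subspace -/

variable {Df K : Set X} {f : X → ℝ}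

/-- **Theorem 31.4**, the weak inequality: for `x ∈ K ∩ dom f` and `x* ∈ K* = −K°`
(`⟨x*, ·⟩ ≥ 0` on `K`), `−f*(x*) ≤ f(x)`.
[cite: Rockafellar1970, §31 Thm 31.4 (held chunk p0288)] -/
theorem neg_fenchelConj_le_of_mem_cone {x : X} (hxK : x ∈ K) (hx : x ∈ Df) {xs : X →L[ℝ] ℝ}
    (hxs : ∀ y ∈ K, 0 ≤ xs y) : -fenchelConj Df f xs ≤ (f x : EReal) := by
  have h := le_fenchelConj (f := f) xs hx
  have h1 : -fenchelConj Df f xs ≤ ((-(xs x - f x) : ℝ) : EReal) := by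
    rw [EReal.coe_neg]; exact EReal.neg_le_neg_iff.2 h
  refine h1.trans (EReal.coe_le_coe_iff.2 ?_)
  linarith [hxs x hxK]

/-- **Theorem 31.4** under condition (a), encoded with the interior-point qualification: let `f` be
convex on `dom f` and `K` a convex cone containing `0`; if some `x₀ ∈ K` has `dom f` a
neighbourhood of `x₀` at which `f` is continuous, then
`inf {f(x) | x ∈ K} = −inf {f*(x*) | x* ∈ K*} = sup {−f*(x*) | x* ∈ K*}`, where
`K* = {x* | ⟨x*, x⟩ ≥ 0 ∀ x ∈ K}` is the negative of the polar of `K`, and the dual extremum is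
attained. [cite: Rockafellar1970, §31 Thm 31.4 (a) (held chunk p0288)] -/
theorem iInf_cone_eq_iSup_neg_fenchelConj (hf : ConvexOn ℝ Df f) (hK : Convex ℝ K)
    (hcone : ∀ x ∈ K, ∀ t : ℝ, 0 < t → t • x ∈ K) (h0 : (0 : X) ∈ K) {x₀ : X} (hx₀ : x₀ ∈ K)
    (hDf : Df ∈ 𝓝 x₀) (hfc : ContinuousAt f x₀) :
    ⨅ x ∈ K ∩ Df, ((f x : ℝ) : EReal) =
        ⨆ xs ∈ {xs : X →L[ℝ] ℝ | ∀ y ∈ K, 0 ≤ xs y}, -fenchelConj Df f xs ∧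
      ∃ xs ∈ {xs : X →L[ℝ] ℝ | ∀ y ∈ K, 0 ≤ xs y},
        -fenchelConj Df f xs = ⨅ x ∈ K ∩ Df, ((f x : ℝ) : EReal) := by
  obtain ⟨hPD, ys, hys⟩ :=
    fenchel_duality (convexOn_const (0 : ℝ) hK) hf (ContinuousLinearMap.id ℝ X) hx₀ hDf hfc
  have hP : fenchelPrimalValue K (fun _ => (0 : ℝ)) Df f (ContinuousLinearMap.id ℝ X) =
      ⨅ x ∈ K ∩ Df, ((f x : ℝ) : EReal) := by
    simp only [fenchelPrimalValue, ContinuousLinearMap.coe_id', id_eq, sep_mem_eq, zero_add]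
  -- the dual objective, termwise: `−ι_K*(z*) − f*(−z*)` is `−f*(−z*)` on `K°` and `−∞` off it
  have hterm₁ : ∀ zs : X →L[ℝ] ℝ, zs ∈ negPolarCone K →
      -fenchelConj K (fun _ => (0 : ℝ)) (zs.comp (ContinuousLinearMap.id ℝ X)) -
          fenchelConj Df f (-zs) = -fenchelConj Df f (-zs) := fun zs hzs => by
    rw [ContinuousLinearMap.comp_id,
      Literature.Analysis.Convex.FenchelConjugate.fenchelConj_indicator_cone_of_mem h0 hzs,
      neg_zero, zero_sub]
  have hterm₂ : ∀ zs : X →L[ℝ] ℝ, zs ∉ negPolarCone K →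
      -fenchelConj K (fun _ => (0 : ℝ)) (zs.comp (ContinuousLinearMap.id ℝ X)) -
          fenchelConj Df f (-zs) = ⊥ := fun zs hzs => by
    rw [ContinuousLinearMap.comp_id,
      Literature.Analysis.Convex.FenchelConjugate.fenchelConj_indicator_cone_of_not_mem hcone hzs,
      EReal.neg_top, EReal.bot_sub]
  -- membership in `K°` versus `K*`
  have hneg : ∀ zs : X →L[ℝ] ℝ,
      zs ∈ negPolarCone K ↔ -zs ∈ {xs : X →L[ℝ] ℝ | ∀ y ∈ K, 0 ≤ xs y} := fun zs => by
    simp only [mem_negPolarCone_iff, mem_setOf_eq, neg_apply, neg_nonneg]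
  have hD : fenchelDualValue K (fun _ => (0 : ℝ)) Df f (ContinuousLinearMap.id ℝ X) =
      ⨆ xs ∈ {xs : X →L[ℝ] ℝ | ∀ y ∈ K, 0 ≤ xs y}, -fenchelConj Df f xs := by
    apply le_antisymm
    · refine iSup_le fun zs => ?_
      by_cases hzs : zs ∈ negPolarCone K
      · rw [hterm₁ zs hzs]
        exact le_iSup₂_of_le (f := fun xs (_ : xs ∈ {xs : X →L[ℝ] ℝ | ∀ y ∈ K, 0 ≤ xs y}) =>
          -fenchelConj Df f xs) (-zs) ((hneg zs).1 hzs) le_rfl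
      · rw [hterm₂ zs hzs]
        exact bot_le
    · refine iSup₂_le fun xs hxs => ?_
      have hxs' : -xs ∈ negPolarCone K := by rw [hneg, neg_neg]; exact hxs
      refine le_iSup_of_le (-xs) ?_
      rw [hterm₁ (-xs) hxs', neg_neg]
  refine ⟨hP ▸ hD ▸ hPD, ?_⟩
  rw [hD] at hys
  rw [← hP, hPD, hD]
  by_cases hys' : ys ∈ negPolarCone K
  · refine ⟨-ys, (hneg ys).1 hys', ?_⟩
    rw [← hys, hterm₁ ys hys']
  · -- the dual value is `−∞`: every `x* ∈ K*` attains it, e.g. `x* = 0`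
    rw [hterm₂ ys hys'] at hys
    refine ⟨0, fun y _ => le_rfl, le_antisymm ?_ (hys ▸ bot_le)⟩
    exact le_iSup₂_of_le (f := fun xs (_ : xs ∈ {xs : X →L[ℝ] ℝ | ∀ y ∈ K, 0 ≤ xs y}) =>
      -fenchelConj Df f xs) 0 (fun y _ => le_rfl) le_rfl

/-- **Theorem 31.4**, the optimality conditions: for `x ∈ K ∩ dom f` and `x* ∈ K*`,
`f(x) = −f*(x*)` (so that both extrema are attained, at `x` and `x*`, and are the negatives of
each other) if and only if `x* ∈ ∂f(x)` and `⟨x, x*⟩ = 0`.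
[cite: Rockafellar1970, §31 Thm 31.4 (held chunk p0288)] -/
theorem coe_eq_neg_fenchelConj_iff {x : X} (hxK : x ∈ K) (hx : x ∈ Df) {xs : X →L[ℝ] ℝ}
    (hxs : ∀ y ∈ K, 0 ≤ xs y) :
    ((f x : ℝ) : EReal) = -fenchelConj Df f xs ↔ (∀ y ∈ Df, xs (y - x) ≤ f y - f x) ∧ xs x = 0 := by
  rw [← fenchelConj_eq_iff_subgradient hx xs]
  constructor
  · intro h
    have h' : fenchelConj Df f xs = ((-f x : ℝ) : EReal) := by rw [EReal.coe_neg, h, neg_neg]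
    have hle := le_fenchelConj (f := f) xs hx
    rw [h', EReal.coe_le_coe_iff] at hle
    have h0 : xs x = 0 := le_antisymm (by linarith) (hxs x hxK)
    refine ⟨?_, h0⟩
    rw [h', h0, zero_sub]
  · rintro ⟨h, h0⟩
    rw [h, h0, zero_sub, EReal.coe_neg, neg_neg]

/-- **Theorem 31.4**, optimality from the conditions: if `x ∈ K ∩ dom f` and `x* ∈ K*` satisfy
`f(x) = −f*(x*)`, then `x` minimises `f` over `K` and `x*` maximises `−f*` over `K*`.
[cite: Rockafellar1970, §31 Thm 31.4 (held chunk p0288)] -/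
theorem isMinOn_of_coe_eq_neg_fenchelConj {x : X} (hxK : x ∈ K) (hx : x ∈ Df) {xs : X →L[ℝ] ℝ}
    (hxs : ∀ y ∈ K, 0 ≤ xs y) (h : ((f x : ℝ) : EReal) = -fenchelConj Df f xs) :
    IsMinOn f (K ∩ Df) x ∧
      ∀ zs ∈ {xs : X →L[ℝ] ℝ | ∀ y ∈ K, 0 ≤ xs y}, -fenchelConj Df f zs ≤ -fenchelConj Df f xs := by
  refine ⟨fun y hy => ?_, fun zs hzs => h ▸ neg_fenchelConj_le_of_mem_cone hxK hx hzs⟩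
  have := neg_fenchelConj_le_of_mem_cone (f := f) hy.1 hy.2 hxs
  rw [← h, EReal.coe_le_coe_iff] at this
  exact this

/-- **Corollary 31.4.2**, encoded with the interior-point qualification: for `f` convex on `dom f`
and a subspace `L` meeting a point `x₀` with `dom f` a neighbourhood of `x₀` at which `f` is
continuous, `inf {f(x) | x ∈ L} = −inf {f*(x*) | x* ∈ L^⊥} = sup {−f*(x*) | x* ∈ L^⊥}`, with the
dual extremum attained. [cite: Rockafellar1970, §31 Cor 31.4.2 (held chunk p0289)] -/
theorem iInf_submodule_eq_iSup_neg_fenchelConj (hf : ConvexOn ℝ Df f) (L : Submodule ℝ X) {x₀ : X}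
    (hx₀ : x₀ ∈ L) (hDf : Df ∈ 𝓝 x₀) (hfc : ContinuousAt f x₀) :
    ⨅ x ∈ (L : Set X) ∩ Df, ((f x : ℝ) : EReal) =
        ⨆ xs ∈ {xs : X →L[ℝ] ℝ | ∀ y ∈ L, xs y = 0}, -fenchelConj Df f xs ∧
      ∃ xs ∈ {xs : X →L[ℝ] ℝ | ∀ y ∈ L, xs y = 0},
        -fenchelConj Df f xs = ⨅ x ∈ (L : Set X) ∩ Df, ((f x : ℝ) : EReal) := by
  have hcone : ∀ x ∈ (L : Set X), ∀ t : ℝ, 0 < t → t • x ∈ (L : Set X) :=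
    fun x hx t _ => L.smul_mem t hx
  have hS : {xs : X →L[ℝ] ℝ | ∀ y ∈ (L : Set X), 0 ≤ xs y} =
      {xs : X →L[ℝ] ℝ | ∀ y ∈ L, xs y = 0} := by
    ext xs
    simp only [mem_setOf_eq, SetLike.mem_coe]
    refine ⟨fun h y hy => le_antisymm ?_ (h y hy), fun h y hy => (h y hy).ge⟩
    have := h (-y) (L.neg_mem hy)
    rw [map_neg] at this
    linarith
  have h := iInf_cone_eq_iSup_neg_fenchelConj hf L.convex hcone L.zero_mem hx₀ hDf hfc
  rw [hS] at h
  exact h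

end Cone

end Literature.Analysis.Convex.FenchelDualityTheorem
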